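import Summits.PneNP.PneNP.Theorems.SliceTarget.Negative.LoadBearing

/-!
# `SliceTarget` (stmt-PneNP-2832) — negative-side lemmas II: shape of the witnesses `(k, δ)` and three natural
# strengthenings refuted

* §2 `not_sliceLB_of_le` (`3 ≤ k ≤ c`, any `δ ≥ 0`: the exact monotone DNF has `≤ C(n,k)(C(k,2)+1) ≤ n^k` gates,
  `dnfSize_le_pow`), `exponent_lt_of_sliceLB` (**every witness has `k ≥ c + 1`**); `card_slice_filter_true_le`
  (hypergeometric single-edge count on a slice), `card_errSet_input_le` (first moment for `x_{e₀}`),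
  `not_sliceLB_of_factorial_inv_lt` / `delta_le_of_sliceLB` (**every witness has `δ ≤ 1/k!`**, at every exponent);
  `witness_shape`.
* §3 `not_sliceTargetKFirst` (one `k` for all `c`), `not_sliceTargetForallK` (every `k ≥ 3`), `not_sliceTargetDeltaFirst`
  (`∃ δ ∀ c ∃ k`): all FALSE — `k(c) → ∞` and `δ(c) → 0` are forced.

Refuter seat cdisprove-stmt-PneNP-2832 (gen 1), 2026-08-16; see `LoadBearing.lean` for the vocabulary.
-/

set_option linter.dupNamespace false

namespace Summit.PneNP.PneNP.Theorems.SliceTarget.Negative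

open Literature.Computability.Complexity Filter Finset Classical
open Summit.PneNP.PneNP.Theses.OneSlice (SliceTarget ConstantBand SliceMonotonization)
open Summit.PneNP.PneNP.Theorems.ConstantBand.Negative (Edge thr Central central_thr slice errSet bandErr
  BandLB bandErr_eq_zero_of_eval exists_oneGate_cliqueFn cliqueFn_eq_true_of_card_false_le le_choose_two
  exists_orAll)
open Summit.PneNP.PneNP.Theorems.SliceACZero.Negative (mk sliceCard sliceErr sliceCard_eq card_slice_supset_le
  choose_sub_mul_pow_le_choose_mul_pow firstMoment_slice mk_le_choose choose_le_edgeCount_of_cliqueFn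
  eq_false_of_edgeCount_eq_zero eq_true_of_edgeCount_eq cliqueFn_false cliqueFn_true exists_edge input_facts
  factorial_inv_le_of_ceil_lt)
open Summit.PneNP.PneNP.Theorems.SingleThreshold.Negative (pc pc_nonneg pc_le_one tendsto_pc
  exists_monotone_cliqueCircuit choose_mul_le_pow)

/-! ## §2 Tightness of the witnesses `(k, δ)`: `c ≤ k + 1` and `δ ≤ 1/k!` are forced -/

/-- `C(k,2) + 1 ≤ k!` for `k ≥ 3` (`C(k,2) + 1 ≤ 2·C(k,2) ≤ k(k-1) ≤ k·(k-1)! = k!`). [folklore] -/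
theorem choose_two_succ_le_factorial {k : ℕ} (hk : 3 ≤ k) : k.choose 2 + 1 ≤ k.factorial := by
  have h1 : 1 ≤ k.choose 2 := Nat.choose_pos (by omega)
  have h2 : 2 * k.choose 2 ≤ k * (k - 1) := by
    rw [Nat.choose_two_right]
    exact Nat.mul_div_le (k * (k - 1)) 2
  have h3 : k * (k - 1) ≤ k.factorial := by
    rw [← Nat.mul_factorial_pred (by omega : k ≠ 0)]
    exact Nat.mul_le_mul_left k (Nat.self_le_factorial _)
  omega

/-- **The exact DNF is small**: `C(n,k)·(C(k,2)+1) ≤ C(n,k)·k! = n(n-1)⋯(n-k+1) ≤ n^k` (`k ≥ 3`). [folklore] -/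
theorem dnfSize_le_pow {n k : ℕ} (hk : 3 ≤ k) : n.choose k * (k.choose 2 + 1) ≤ n ^ k :=
  calc n.choose k * (k.choose 2 + 1) ≤ n.choose k * k.factorial :=
        Nat.mul_le_mul_left _ (choose_two_succ_le_factorial hk)
    _ = n.descFactorial k := by rw [mul_comm, Nat.descFactorial_eq_factorial_mul_choose]
    _ ≤ n ^ k := Nat.descFactorial_le_pow n k

/-- **Small `k` is refuted by brute force**: for `3 ≤ k ≤ c` and every `δ ≥ 0`, `SliceLB c k δ` is FALSE — the
exact monotone DNF (`≤ C(n,k)(C(k,2)+1) ≤ n^k ≤ n^c` gates) has error `0` on every slice. [folklore] -/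
theorem not_sliceLB_of_le {c k : ℕ} {δ : ℝ} (hk : 3 ≤ k) (hc : k ≤ c) (hδ : 0 ≤ δ) : ¬ SliceLB c k δ := by
  intro H
  obtain ⟨n, hn, hnk⟩ := (H.and (eventually_ge_atTop (k + 1))).exists
  obtain ⟨C, hCB, hs, he⟩ := exists_monotone_cliqueCircuit (n := n) (k := k) (by omega) (by omega)
  have hlt := hn (thr k n) (central_thr k n) C hCB
    (by rw [errSet_eq_empty_of fun x _ => he x, card_empty, Nat.cast_zero]; positivity)
  have h1 : C.size ≤ n ^ k := hs.trans (dnfSize_le_pow hk)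
  have h3 : n ^ k ≤ n ^ c := Nat.pow_le_pow_right (by omega) hc
  omega

/-- **Every witness has `k ≥ c + 1`**: the clique size must EXCEED the exponent (in truth `k ≳ 4c`, by Rossman's
`n^{k/4+O(1)}` average-case upper bound, FOCS'10 Thm 3 = `Rossman2010_upperBound` — not needed here). [folklore] -/
theorem exponent_lt_of_sliceLB {c k : ℕ} {δ : ℝ} (hk : 3 ≤ k) (hδ : 0 ≤ δ) (H : SliceLB c k δ) : c < k := by
  by_contra hc
  exact not_sliceLB_of_le hk (not_lt.1 hc) hδ H

/-- On slice `j ≤ C(n,2)` the graphs switching a fixed edge on are a `j/C(n,2)`-fraction (hypergeometric: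
`C(N-1,j-1)·N = C(N,j)·j`). [folklore] -/
theorem card_slice_filter_true_le {n j : ℕ} (e₀ : Edge n) (hj : j ≤ n.choose 2) :
    (#((slice n j).filter fun x => x e₀ = true) : ℝ) ≤ (j : ℝ) / n.choose 2 * #(slice n j) := by
  rcases Nat.eq_zero_or_pos j with rfl | hj0
  · have h0 : (slice n 0).filter (fun x => x e₀ = true) = ∅ := by
      refine filter_eq_empty_iff.2 fun x hx h => ?_
      have hx0 := eq_false_of_edgeCount_eq_zero (mem_filter.1 hx).2
      rw [hx0] at h
      exact Bool.false_ne_true h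
    rw [h0, card_empty, Nat.cast_zero]
    positivity
  · have hN : 0 < n.choose 2 := by omega
    have h1 : #((slice n j).filter fun x => x e₀ = true) ≤ (n.choose 2 - 1).choose (j - 1) := by
      have h := card_slice_supset_le (n := n) j ({e₀} : Finset (Edge n)) (by rw [card_singleton]; omega)
      rw [card_singleton] at h
      refine le_trans (le_of_eq ?_) h
      rw [Summit.PneNP.PneNP.Theorems.ConstantBand.Negative.slice, filter_filter]
      congr 1
      refine filter_congr fun x _ => ?_
      simp
    have h2 : (n.choose 2 - 1).choose (j - 1) * n.choose 2 ≤ (n.choose 2).choose j * j := by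
      simpa using choose_sub_mul_pow_le_choose_mul_pow (K := 1) hj0 hj
    rw [card_slice_eq_sliceCard, sliceCard_eq, div_mul_eq_mul_div, le_div_iff₀ (by exact_mod_cast hN)]
    calc (#((slice n j).filter fun x => x e₀ = true) : ℝ) * n.choose 2
        ≤ ((n.choose 2 - 1).choose (j - 1) : ℝ) * n.choose 2 := by
          exact_mod_cast Nat.mul_le_mul_right (n.choose 2) h1
      _ ≤ (n.choose 2).choose j * j := by exact_mod_cast h2
      _ = j * ((n.choose 2).choose j : ℕ) := mul_comm _ _

/-- The error set of the projection `x_{e₀}` on a slice: `x_{e₀} ≠ CLIQUE_k(x)` forces `x_{e₀} = 1` or a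
`k`-clique. [folklore] -/
theorem errSet_input_subset {n k j : ℕ} (e₀ : Edge n) :
    errSet n k j (Circuit.input e₀) ⊆ (slice n j).filter (fun x => x e₀ = true) ∪
      univ.filter (fun x : Edge n → Bool => edgeCount x = j ∧ cliqueFn n k x = true) := by
  intro x hx
  rw [errSet, mem_filter] at hx
  obtain ⟨-, hj, hne⟩ := hx
  rw [Circuit.eval_input] at hne
  have hxs : x ∈ slice n j := mem_filter.2 ⟨mem_univ _, hj⟩
  rw [mem_union, mem_filter, mem_filter]
  cases h0 : x e₀ with
  | true => exact Or.inl ⟨hxs, rfl⟩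
  | false =>
    refine Or.inr ⟨mem_univ _, hj, ?_⟩
    cases h1 : cliqueFn n k x with
    | true => rfl
    | false => exact absurd (h0.trans h1.symm) hne

/-- **First moment on a slice `j ≤ C(n,2)` at or below the real threshold `C(n,2)·n^{-2/(k-1)}`**: the graphs with
`x_{e₀} = 1` or a `k`-clique number at most `(j/C(n,2) + 1/k!)·#slice_j`. [folklore] -/
theorem card_onEdge_union_clique_le {n k j : ℕ} (hk : 2 ≤ k) (hn : 2 ≤ n) (e₀ : Edge n) (hjN : j ≤ n.choose 2)
    (hjT : (j : ℝ) ≤ (n.choose 2 : ℕ) * (n : ℝ) ^ (-(2 : ℝ) / ((k : ℝ) - 1))) :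
    (#((slice n j).filter (fun x => x e₀ = true) ∪
        univ.filter (fun x : Edge n → Bool => edgeCount x = j ∧ cliqueFn n k x = true)) : ℝ) ≤
      ((j : ℝ) / n.choose 2 + 1 / k.factorial) * #(slice n j) := by
  have hA := card_slice_filter_true_le e₀ hjN
  have hB : (#(univ.filter fun x : Edge n → Bool => edgeCount x = j ∧ cliqueFn n k x = true) : ℝ) ≤
      1 / k.factorial * #(slice n j) := by
    by_cases hKj : k.choose 2 ≤ j
    · exact firstMoment_slice (n := n) hk (by omega) hKj hjN hjT
    · have h0 : univ.filter (fun x : Edge n → Bool => edgeCount x = j ∧ cliqueFn n k x = true) = ∅ :=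
        filter_eq_empty_iff.2 fun x _ hx => hKj (hx.1 ▸ choose_le_edgeCount_of_cliqueFn hx.2)
      rw [h0, card_empty, Nat.cast_zero]
      positivity
  calc (#((slice n j).filter (fun x => x e₀ = true) ∪
          univ.filter (fun x : Edge n → Bool => edgeCount x = j ∧ cliqueFn n k x = true)) : ℝ)
      ≤ (#((slice n j).filter fun x => x e₀ = true) : ℝ) +
          #(univ.filter fun x : Edge n → Bool => edgeCount x = j ∧ cliqueFn n k x = true) := by
        exact_mod_cast card_union_le _ _
    _ ≤ (j : ℝ) / n.choose 2 * #(slice n j) + 1 / k.factorial * #(slice n j) := add_le_add hA hB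
    _ = ((j : ℝ) / n.choose 2 + 1 / k.factorial) * #(slice n j) := by ring

/-- **First-moment bound for `x_{e₀}`** on a slice `j ≤ C(n,2)` at or below the real threshold:
`#err_j(x_{e₀}) ≤ (j/C(n,2) + 1/k!)·#slice_j`. [folklore] -/
theorem card_errSet_input_le {n k j : ℕ} (hk : 2 ≤ k) (hn : 2 ≤ n) (e₀ : Edge n) (hjN : j ≤ n.choose 2)
    (hjT : (j : ℝ) ≤ (n.choose 2 : ℕ) * (n : ℝ) ^ (-(2 : ℝ) / ((k : ℝ) - 1))) :
    (#(errSet n k j (Circuit.input e₀)) : ℝ) ≤ ((j : ℝ) / n.choose 2 + 1 / k.factorial) * #(slice n j) :=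
  le_trans (by exact_mod_cast card_le_card (errSet_input_subset e₀)) (card_onEdge_union_clique_le hk hn e₀ hjN hjT)

/-- **The δ-floor.** For `k ≥ 2` and ANY exponent `c`: if `δ > 1/k!` then `SliceLB c k δ` is false — on the
central slice `j = m_k(n)` the gate-free circuit `x_{e₀}` errs on at most `(m_k(n)/C(n,2) + 1/k!)·#slice`
graphs and `m_k(n)/C(n,2) ≤ n^{-2/(k-1)} → 0`. [folklore] -/
theorem not_sliceLB_of_factorial_inv_lt {c k : ℕ} {δ : ℝ} (hk : 2 ≤ k) (hδ : 1 / (k.factorial : ℝ) < δ) :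
    ¬ SliceLB c k δ := by
  intro H
  have hε : 0 < δ - 1 / k.factorial := sub_pos.2 hδ
  have hev : ∀ᶠ n : ℕ in atTop, pc n k < δ - 1 / k.factorial :=
    (tendsto_pc hk).eventually (gt_mem_nhds hε)
  obtain ⟨n, hn, hpn, hn2⟩ := (H.and (hev.and (eventually_ge_atTop 2))).exists
  obtain ⟨e₀⟩ := exists_edge hn2
  have hN : 0 < n.choose 2 := Nat.choose_pos hn2
  have hjT : (thr k n : ℝ) ≤ (n.choose 2 : ℕ) * (n : ℝ) ^ (-(2 : ℝ) / ((k : ℝ) - 1)) :=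
    Nat.floor_le (by positivity)
  have hjN : thr k n ≤ n.choose 2 := mk_le_choose (by omega) hk
  have hratio : (thr k n : ℝ) / n.choose 2 ≤ pc n k := by
    rw [div_le_iff₀ (by exact_mod_cast hN), pc, mul_comm]
    exact hjT
  have herr : (#(errSet n k (thr k n) (Circuit.input e₀)) : ℝ) ≤ δ * #(slice n (thr k n)) :=
    (card_errSet_input_le hk hn2 e₀ hjN hjT).trans
      (mul_le_mul_of_nonneg_right (by linarith) (Nat.cast_nonneg _))
  have hlt := hn (thr k n) (central_thr k n) (Circuit.input e₀) (input_isOver e₀ _) herr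
  rw [Circuit.size_input] at hlt
  exact Nat.not_lt_zero _ hlt

/-- **Every witness has `δ ≤ 1/k!`** — the accuracy demanded must shrink factorially in `k` (the true floor
for near-constant circuits is `1 - e^{-1/k!}`, second moment; not needed here). [folklore] -/
theorem delta_le_of_sliceLB {c k : ℕ} {δ : ℝ} (hk : 2 ≤ k) (H : SliceLB c k δ) : δ ≤ 1 / (k.factorial : ℝ) :=
  le_of_not_gt fun h => not_sliceLB_of_factorial_inv_lt hk h H

/-- **Shape of every witness** `(k, δ)` of the crux at exponent `c`: `k ≥ c + 1` AND `δ ≤ 1/k!` — so a proof of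
`SliceTarget` at exponent `c` is a statement about `(c+1)!^{-1}`-accurate circuits at the least. [folklore] -/
theorem witness_shape {c k : ℕ} {δ : ℝ} (hk : 3 ≤ k) (hδ : 0 ≤ δ) (H : SliceLB c k δ) :
    c < k ∧ δ ≤ 1 / (k.factorial : ℝ) :=
  ⟨exponent_lt_of_sliceLB hk hδ H, delta_le_of_sliceLB (by omega) H⟩

/-! ## §3 Natural strengthenings (quantifier orders) refuted -/

/-- **"One `k` for every `c`" is FALSE** (exact DNF at `c = k`). [folklore] -/
theorem not_sliceTargetKFirst : ¬ ∃ k : ℕ, 3 ≤ k ∧ ∀ c : ℕ, ∃ δ : ℝ, 0 < δ ∧ SliceLB c k δ := by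
  rintro ⟨k, hk, h⟩
  obtain ⟨δ, hδ, H⟩ := h k
  exact not_sliceLB_of_le hk le_rfl hδ.le H

/-- **"Every `k ≥ 3` works" is FALSE** (`k = 3`, `c = 3`: the exact triangle DNF has `≤ 4·C(n,3) ≤ n^3` gates). [folklore] -/
theorem not_sliceTargetForallK : ¬ ∀ c : ℕ, ∀ k : ℕ, 3 ≤ k → ∃ δ : ℝ, 0 < δ ∧ SliceLB c k δ := by
  intro h
  obtain ⟨δ, hδ, H⟩ := h 3 3 le_rfl
  exact not_sliceLB_of_le le_rfl le_rfl hδ.le H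

/-- If `k > ⌈1/δ⌉₊ + 1` then `1/k! < δ` (strictly). [folklore] -/
theorem factorial_inv_lt_of_lt {δ : ℝ} (hδ : 0 < δ) {k : ℕ} (hk : ⌈1 / δ⌉₊ + 1 < k) :
    1 / (k.factorial : ℝ) < δ := by
  have h1 : 1 / ((k - 1).factorial : ℝ) ≤ δ := factorial_inv_le_of_ceil_lt hδ (by omega)
  have h2 : ((k - 1).factorial : ℝ) < k.factorial := by
    exact_mod_cast (Nat.factorial_lt (by omega : 0 < k - 1)).2 (by omega)
  have h3 : 1 / (k.factorial : ℝ) < 1 / ((k - 1).factorial : ℝ) :=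
    one_div_lt_one_div_of_lt (by positivity) h2
  exact h3.trans_le h1

/-- **"`δ` before `k`" is FALSE**: the quantifier order `∃ δ > 0, ∀ c, ∃ k ≥ 3` fails — given `δ`, at
`c = ⌈1/δ⌉₊ + 2` a witness `k ≤ c` dies by the exact DNF (§2) and a witness `k ≥ c + 1 = ⌈1/δ⌉₊ + 3` has
`1/k! < δ` and dies by the gate-free circuit `x_e` (δ-floor). The crux's `δ = δ(c)` must tend to `0`. [folklore] -/
theorem not_sliceTargetDeltaFirst : ¬ ∃ δ : ℝ, 0 < δ ∧ ∀ c : ℕ, ∃ k : ℕ, 3 ≤ k ∧ SliceLB c k δ := by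
  rintro ⟨δ, hδ, h⟩
  obtain ⟨k, hk, H⟩ := h (⌈1 / δ⌉₊ + 2)
  by_cases hkc : k ≤ ⌈1 / δ⌉₊ + 2
  · exact not_sliceLB_of_le hk hkc hδ.le H
  · exact not_sliceLB_of_factorial_inv_lt (by omega) (factorial_inv_lt_of_lt hδ (by omega)) H

end Summit.PneNP.PneNP.Theorems.SliceTarget.Negative
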